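import Summits.QuantumFields.YangMills.Theorems.UnitScaleTiltFluctuationComparisonRegPrGlobalSlackCanonicalPolymersCoreSizes
import Summits.QuantumFields.YangMills.Theorems.UnitScaleTiltFluctuationComparisonRegPrGlobalSlackTwoProfile
import HarnessLib

/-!
# `UnitScaleTiltFluctuationComparisonRegPrGlobalSlackCanonicalPolymersCoreSizesProfile` — PRODUCER ROW 5 (THE SIZE ROW (44) AT THE TRIVIAL HISTORY) AT EVERY HIGHER LOG-PROFILE
# `p₁ ≥ p₀`, FOR THE CANONICAL POLYMERISATION OF A FAMILY OF DATA CORES (crux `FluctuationComparisonRegPrIntL`, stmt-QuantumFields-20520, skeleton v5kC, STUB 3⁗χ;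
# width seat ym-ust-20520-w1 g2; count-neutral; YM₃ on the 3-torus is ladder rung R3, not the Clay problem)

WHY.  The K1a chain read through ★ym-ust-19935-r1 g5's higher-profile door (`…GlobalSlackHigherProfile`: the crux accepts the slack row at any `p₁ ≥ 𝔠.p₀`) needs lane A's
composition `globalTwoRunSlackTail_of_chartsC` at the profile `p₁` — and that composition consumes the producer's fifth row `TermSizeTrivT D PT b₀ p₁ C κ₁` AT THE SAME
PROFILE.  ★r1 g4's `termSizeTrivT_canonCore` (p574458) states it at the record's `p₀`; its proof never reads the window hypothesis (the displayed sizes (44)/(34) hold for EVERY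
field), so the row holds at every `p₁ ≥ p₀` by `θ_{b₀,p₀} ≤ θ_{b₀,p₁}` (`GlobalSlackOn.θBal_mono_p`).  This file makes the field-uniform size bound a named theorem and reads it
at `p₁`:

* §1 **`abs_canonPTCore_le_theta_sq`** — for `k + 1 ≤ K`, `1 ≤ i ≤ k + 1`, every listed domain `Y ∈ canonLocCore q K (k+1) triv i` and EVERY level-`(k+1)` field `W`:
  `|canonPTCore q K (k+1) i Y W| ≤ max(newConst, oldConst·L⁴·e^{κ₁L³})·e^{−κ₁·𝓛_K(i,Y)}·θ_{b₀,p₀}(K−k)²·L^{−4(k+1−i)}` (★r1 g4's proof body, verbatim, as a theorem);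
* §2 **`termSizeTrivT_canonCore_profile`** : `p₀ ≤ p₁ → TermSizeTrivT (dataOfCoreV3 q (canonPolymerCore q)) (canonPTCore q) 𝔠.b₀ p₁ (max newConst (oldConst·L⁴·e^{κ₁L³})) κ₁`
  (same constant, same two coupling windows, no letter on `M₁`).
HONEST FRAMING: bookkeeping over the core's displayed rows; nothing of [Balaban1985UV3] asserted; registry untouched (`--supports stmt-QuantumFields-20520`); no claim on the stub,
the crux, d = 4 or the mass gap.

References: T. Bałaban, CMP 102 (1985) 255–275 [Balaban1985UV3] ((7) p.257, (24)–(25) p.262, (28) p.263, (34) p.264, (43)–(46) pp.266–267); C. King, CMP 102 (1986) 649–677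
[King1986] (Thm 3.4 (3.9) p.656).
-/

set_option autoImplicit false

noncomputable section

namespace Summit.QuantumFields.YangMills.Theorems.GlobalSlackCanonicalPolymers

open scoped BigOperators
open Finset
open Literature.MathematicalPhysics.QuantumFieldTheory.Balaban1983to89
open Literature.MathematicalPhysics.QuantumFieldTheory.Balaban1983to89.T3ContinuumYM3Torus
open Literature.MathematicalPhysics.QuantumFieldTheory.Balaban1983to89.T3UnitScaleTilt (θBal)
open Literature.MathematicalPhysics.QuantumFieldTheory.Balaban1983to89.T3LevelShift (fieldShift)
open Literature.MathematicalPhysics.QuantumFieldTheory.Balaban1983to89.T3AlphaInputsAC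
open Literature.MathematicalPhysics.QuantumFieldTheory.Balaban1983to89.T3AlphaInputsACTwoRunLevel
open Literature.MathematicalPhysics.QuantumFieldTheory.Balaban1983to89.TreeLengthTorus (tsys)
open Literature.MathematicalPhysics.QuantumFieldTheory.Balaban1985CMP102
open Literature.MathematicalPhysics.QuantumFieldTheory.Balaban1985CMP102.Setting
open Summit.QuantumFields.Balaban3D.Carriers
open Summit.QuantumFields.Balaban3D.Proofs.Primitives
open Summit.QuantumFields.YangMills.Theorems

variable {F : T3Family} {𝔠 : AlphaConsts F.L (suGroupModel 2).N} {γ : ℝ} {hγ : 0 < γ} {hγ1 : γ ≤ (min 𝔠.gamma0 1) ^ 2}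

/-! ## §1 The field-uniform size of the canonical terms (★r1 g4's proof body as a theorem) -/

/-- **THE CANONICAL TERMS OBEY PRINT'S (44) FOR EVERY FIELD** (no window): for `0 < κ₁ ≤ 𝔠.κ`, the two coupling windows of `…CoreSizes` along run `K`, `k + 1 ≤ K`, `1 ≤ i ≤ k + 1`,
every `Y ∈ canonLocCore q K (k+1) triv i` and every level-`(k+1)` field `W`,
`|canonPTCore q K (k+1) i Y W| ≤ max (newConst 𝔠) (oldConst 𝔠·L⁴·e^{κ₁L³}) · e^{−κ₁·canonTreeLenCore q K i Y} · θ_{b₀,p₀}(K−k)² · (L^{k+1−i})⁻⁴` — NEW terms by `abs_newTermCore_le_theta`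
(tree length = `dj`, `κ₁ ≤ κ`), OLD block terms by `abs_oldTermCore_le` (`ℓ_i⁴ = L⁴·(L^{k+1−i})⁻⁴`, tree length `≤ L³` paid by `e^{κ₁L³}`). [cite: Balaban1985UV3, (44)-(45) p.267, (34) p.264, (24)-(25) p.262] -/
theorem abs_canonPTCore_le_theta_sq (q : ∀ K, AlphaInputsT3AC.PkgCoreV3 F 𝔠 γ hγ hγ1 K) {κ₁ : ℝ} (hκ₁ : 0 < κ₁) (hκle : κ₁ ≤ 𝔠.κ) (K k : ℕ) (hkK : k + 1 ≤ K)
    (hw1 : 𝔠.cB * (B10.rFun 𝔠.r₀ ((SK F 𝔠 γ hγ hγ1 K).gk k) * (SK F 𝔠 γ hγ hγ1 K).gk k *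
        B10.pFun 𝔠.b₀ 𝔠.p₀ ((SK F 𝔠 γ hγ hγ1 K).gk k)) ≤ 𝔠.ρ / 4)
    (hw2 : 8 * (F.L : ℝ) ^ 2 * 𝔠.B₃ * 𝔠.Zfull * ((SK F 𝔠 γ hγ hγ1 K).gk k * B10.pFun 𝔠.b₀ 𝔠.p₀ ((SK F 𝔠 γ hγ hγ1 K).gk k)) ≤ 1 / 2)
    (i : ℕ) (hi1 : 1 ≤ i) (hi2 : i ≤ k + 1) (Y : Set (Site (F.P K) 0)) (hY : Y ∈ canonLocCore q K (k + 1) (Hist.triv (F.P K) (k + 1)) i)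
    (W : GaugeField (F.P K) (k + 1) (Matrix.specialUnitaryGroup (Fin 2) ℂ)) :
    |canonPTCore q K (k + 1) i Y W| ≤
      max (newConst 𝔠) (oldConst 𝔠 * (F.L : ℝ) ^ 4 * Real.exp (κ₁ * (F.L : ℝ) ^ 3)) * Real.exp (-κ₁ * canonTreeLenCore q K i Y) *
        θBal F.L γ 𝔠.b₀ 𝔠.p₀ (K - k) ^ 2 * (((F.L : ℝ) ^ (k + 1 - i))⁻¹) ^ 4 := by
  classical
  have hkm : k ≤ F.m + K := by have := F.hm; omega
  have hL1 : (1 : ℝ) ≤ F.L := by exact_mod_cast F.hL.2.le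
  have hL0 : (0 : ℝ) < F.L := by linarith
  have hθ2 : 0 ≤ θBal F.L γ 𝔠.b₀ 𝔠.p₀ (K - k) ^ 2 := sq_nonneg _
  have hmax0 : 0 ≤ max (newConst 𝔠) (oldConst 𝔠 * (F.L : ℝ) ^ 4 * Real.exp (κ₁ * (F.L : ℝ) ^ 3)) :=
    le_max_of_le_left (newConst_nonneg 𝔠)
  by_cases hik : i = k + 1
  · -- NEW term of a retained domain
    subst hik
    simp only [canonLocCore, if_pos hkK, ite_true, mem_image] at hY
    obtain ⟨X, hX, rfl⟩ := hY
    rw [canonPTCore_new_eq q K k hkK X hX W, canonTreeLenCore_domSet q K k hkm X]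
    have hb := abs_newTermCore_le_theta q K k hkK hw1 X W
    refine hb.trans ?_
    have hx : (((F.L : ℝ) ^ (k + 1 - (k + 1)))⁻¹) ^ 4 = 1 := by simp
    rw [hx, mul_one]
    have hexp : Real.exp (-(𝔠.κ * (tsys 3 (nblkOf (SK F 𝔠 γ hγ hγ1 K) 𝔠.lane.carrier k)).dj X)) ≤
        Real.exp (-κ₁ * (tsys 3 (nblkOf (SK F 𝔠 γ hγ hγ1 K) 𝔠.lane.carrier k)).dj X) := by
      rw [Real.exp_le_exp]
      have := (tsys 3 (nblkOf (SK F 𝔠 γ hγ hγ1 K) 𝔠.lane.carrier k)).dj_nonneg X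
      nlinarith
    calc newConst 𝔠 * θBal F.L γ 𝔠.b₀ 𝔠.p₀ (K - k) ^ 2 * Real.exp (-(𝔠.κ * (tsys 3 _).dj X))
        ≤ max (newConst 𝔠) (oldConst 𝔠 * (F.L : ℝ) ^ 4 * Real.exp (κ₁ * (F.L : ℝ) ^ 3)) * θBal F.L γ 𝔠.b₀ 𝔠.p₀ (K - k) ^ 2 *
            Real.exp (-κ₁ * (tsys 3 _).dj X) :=
          mul_le_mul (mul_le_mul_of_nonneg_right (le_max_left _ _) hθ2) hexp (Real.exp_pos _).le (mul_nonneg hmax0 hθ2)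
      _ = _ := by ring
  · by_cases hi : i ∈ Finset.Icc 1 k
    · -- OLD term of a block: tree length `≤ L³`, paid by `e^{κ₁L³}` in the constant
      simp only [canonLocCore, if_pos hkK, if_neg hik, if_pos hi, mem_image] at hY
      obtain ⟨y, hy, rfl⟩ := hY
      have him : i ≤ F.m + K := by have := (Finset.mem_Icc.mp hi).2; omega
      rw [canonPTCore_old_eq q K k hkK i hi y hy W]
      have htl := canonTreeLenCore_blockSet_le q K i hi1 him y
      have hb := abs_oldTermCore_le q K k hkK i hi hw2 y W
      have heps : (SK F 𝔠 γ hγ hγ1 K).gk k * B10.pFun 𝔠.b₀ 𝔠.p₀ ((SK F 𝔠 γ hγ hγ1 K).gk k) = θBal F.L γ 𝔠.b₀ 𝔠.p₀ (K - k) :=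
        (q K).eps1_eq k (by omega)
      rw [heps] at hb
      refine hb.trans ?_
      -- `ℓ_i⁴ = L⁴ · (L^{k+1−i})⁻⁴`
      have hik' : i ≤ k := (Finset.mem_Icc.mp hi).2
      have hell : ell (F.P K) k i ^ 4 = (F.L : ℝ) ^ 4 * (((F.L : ℝ) ^ (k + 1 - i))⁻¹) ^ 4 := by
        have e1 : ell (F.P K) k i = ((F.L : ℝ)⁻¹) ^ (k - i) := rfl
        have hL4 : ((F.L : ℝ) * (F.L : ℝ)⁻¹) ^ 4 = 1 := by rw [mul_inv_cancel₀ hL0.ne', one_pow]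
        rw [e1, show k + 1 - i = (k - i) + 1 by omega, pow_succ (F.L : ℝ) (k - i), mul_inv, mul_pow, ← inv_pow (F.L : ℝ) (k - i)]
        calc ((F.L : ℝ)⁻¹ ^ (k - i)) ^ 4 = ((F.L : ℝ)⁻¹ ^ (k - i)) ^ 4 * ((F.L : ℝ) * (F.L : ℝ)⁻¹) ^ 4 := by rw [hL4, mul_one]
          _ = _ := by ring
      rw [hell]
      have hE : 1 ≤ Real.exp (κ₁ * (F.L : ℝ) ^ 3) * Real.exp (-κ₁ * canonTreeLenCore q K i (blockSet K i y)) := by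
        rw [← Real.exp_add]
        refine Real.one_le_exp ?_
        nlinarith
      have hO : 0 ≤ oldConst 𝔠 * (F.L : ℝ) ^ 4 := mul_nonneg (oldConst_nonneg 𝔠) (by positivity)
      have hx4 : 0 ≤ (((F.L : ℝ) ^ (k + 1 - i))⁻¹) ^ 4 := by positivity
      calc oldConst 𝔠 * θBal F.L γ 𝔠.b₀ 𝔠.p₀ (K - k) ^ 2 * ((F.L : ℝ) ^ 4 * (((F.L : ℝ) ^ (k + 1 - i))⁻¹) ^ 4)
          = (oldConst 𝔠 * (F.L : ℝ) ^ 4) * 1 * (θBal F.L γ 𝔠.b₀ 𝔠.p₀ (K - k) ^ 2 * (((F.L : ℝ) ^ (k + 1 - i))⁻¹) ^ 4) := by ring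
        _ ≤ (oldConst 𝔠 * (F.L : ℝ) ^ 4) *
              (Real.exp (κ₁ * (F.L : ℝ) ^ 3) * Real.exp (-κ₁ * canonTreeLenCore q K i (blockSet K i y))) *
              (θBal F.L γ 𝔠.b₀ 𝔠.p₀ (K - k) ^ 2 * (((F.L : ℝ) ^ (k + 1 - i))⁻¹) ^ 4) :=
            mul_le_mul_of_nonneg_right (mul_le_mul_of_nonneg_left hE hO) (mul_nonneg hθ2 hx4)
        _ = (oldConst 𝔠 * (F.L : ℝ) ^ 4 * Real.exp (κ₁ * (F.L : ℝ) ^ 3)) * Real.exp (-κ₁ * canonTreeLenCore q K i (blockSet K i y)) *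
              θBal F.L γ 𝔠.b₀ 𝔠.p₀ (K - k) ^ 2 * (((F.L : ℝ) ^ (k + 1 - i))⁻¹) ^ 4 := by ring
        _ ≤ _ := mul_le_mul_of_nonneg_right (mul_le_mul_of_nonneg_right
              (mul_le_mul_of_nonneg_right (le_max_right _ _) (Real.exp_pos _).le) hθ2) hx4
    · exfalso
      simp only [canonLocCore, if_pos hkK, if_neg hik, if_neg hi] at hY
      simp at hY

/-! ## §2 The size row at every higher profile -/

/-- **`TermSizeTrivT` FOR THE CANONICAL POLYMERISATION OF EVERY FAMILY OF DATA CORES AT EVERY PROFILE `p₁ ≥ p₀`** (same constant and windows as ★r1 g4's `termSizeTrivT_canonCore`):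
the `p₁`-window hypothesis is idle (§1 holds for every field) and `θ_{b₀,p₀}(n+1)² ≤ θ_{b₀,p₁}(n+1)²` (`GlobalSlackOn.θBal_mono_p`).  The producer's fifth row in the currency of
★r1 g5's higher-profile door. [cite: Balaban1985UV3, (44)-(45) p.267, (34) p.264, (7) p.257; King1986, Thm 3.4 (3.9) p.656] -/
theorem termSizeTrivT_canonCore_profile (q : ∀ K, AlphaInputsT3AC.PkgCoreV3 F 𝔠 γ hγ hγ1 K) {κ₁ : ℝ} (hκ₁ : 0 < κ₁) (hκle : κ₁ ≤ 𝔠.κ)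
    (hw1 : ∀ K k, k + 1 ≤ K → 𝔠.cB * (B10.rFun 𝔠.r₀ ((SK F 𝔠 γ hγ hγ1 K).gk k) * (SK F 𝔠 γ hγ hγ1 K).gk k *
        B10.pFun 𝔠.b₀ 𝔠.p₀ ((SK F 𝔠 γ hγ hγ1 K).gk k)) ≤ 𝔠.ρ / 4)
    (hw2 : ∀ K k, k + 1 ≤ K → 8 * (F.L : ℝ) ^ 2 * 𝔠.B₃ * 𝔠.Zfull *
        ((SK F 𝔠 γ hγ hγ1 K).gk k * B10.pFun 𝔠.b₀ 𝔠.p₀ ((SK F 𝔠 γ hγ hγ1 K).gk k)) ≤ 1 / 2)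
    {p₁ : ℝ} (hp : 𝔠.p₀ ≤ p₁) :
    TermSizeTrivT (AlphaInputsT3AC.dataOfCoreV3 q (canonPolymerCore q)) (canonPTCore q) 𝔠.b₀ p₁
      (max (newConst 𝔠) (oldConst 𝔠 * (F.L : ℝ) ^ 4 * Real.exp (κ₁ * (F.L : ℝ) ^ 3))) κ₁ := by
  classical
  refine ⟨hκ₁, fun K n hn V _ i hi1 hi2 Y hY => ?_⟩
  change Y ∈ canonLocCore q K (K - n) (Hist.triv (F.P K) (K - n)) i at hY
  change |canonPTCore q K (K - n) i Y _| ≤ max (newConst 𝔠) (oldConst 𝔠 * (F.L : ℝ) ^ 4 * Real.exp (κ₁ * (F.L : ℝ) ^ 3)) *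
    Real.exp (-κ₁ * canonTreeLenCore q K i Y) * θBal F.L γ 𝔠.b₀ p₁ (n + 1) ^ 2 * (((F.L : ℝ) ^ (K - n - i))⁻¹) ^ 4
  -- name the lattice level `K − n = k + 1`; the bound is field-uniform
  suffices hW : ∀ W : GaugeField (F.P K) (K - n) (Matrix.specialUnitaryGroup (Fin 2) ℂ), |canonPTCore q K (K - n) i Y W| ≤
      max (newConst 𝔠) (oldConst 𝔠 * (F.L : ℝ) ^ 4 * Real.exp (κ₁ * (F.L : ℝ) ^ 3)) * Real.exp (-κ₁ * canonTreeLenCore q K i Y) *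
        θBal F.L γ 𝔠.b₀ p₁ (n + 1) ^ 2 * (((F.L : ℝ) ^ (K - n - i))⁻¹) ^ 4 from hW _
  obtain ⟨k, hk⟩ : ∃ k, K - n = k + 1 := ⟨K - n - 1, by omega⟩
  rw [hk] at hY
  rw [hk]
  intro W
  have hkK : k + 1 ≤ K := by omega
  have hKk : K - k = n + 1 := by omega
  have hγ1' : γ ≤ 1 := hγ1.trans (sq_min_one_le _ 𝔠.gamma0_pos)
  have hb := abs_canonPTCore_le_theta_sq q hκ₁ hκle K k hkK (hw1 K k hkK) (hw2 K k hkK) i hi1 (by omega) Y hY W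
  rw [hKk] at hb
  refine hb.trans ?_
  have hmono : θBal F.L γ 𝔠.b₀ 𝔠.p₀ (n + 1) ^ 2 ≤ θBal F.L γ 𝔠.b₀ p₁ (n + 1) ^ 2 :=
    pow_le_pow_left₀ (T3MinimiserStabilityReduction.θBal_pos F.hL.2.le hγ hγ1' 𝔠.b₀_pos _ _).le
      (GlobalSlackOn.θBal_mono_p F.hL.2.le hγ hγ1' 𝔠.b₀_pos.le hp (n + 1)) 2
  have hc : 0 ≤ max (newConst 𝔠) (oldConst 𝔠 * (F.L : ℝ) ^ 4 * Real.exp (κ₁ * (F.L : ℝ) ^ 3)) * Real.exp (-κ₁ * canonTreeLenCore q K i Y) :=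
    mul_nonneg (le_max_of_le_left (newConst_nonneg 𝔠)) (Real.exp_pos _).le
  have hx4 : 0 ≤ (((F.L : ℝ) ^ (k + 1 - i))⁻¹) ^ 4 := by positivity
  exact mul_le_mul_of_nonneg_right (mul_le_mul_of_nonneg_left hmono hc) hx4

/-- The same at the χ-record's datum (`q := toCore ∘ p`). [cite: Balaban1985UV3, (44)-(45) p.267] -/
theorem termSizeTrivT_canonCore_chi_profile (p : ∀ K, AlphaInputsT3AC.PkgAtV3Chi F 𝔠 γ hγ hγ1 K) {κ₁ : ℝ} (hκ₁ : 0 < κ₁) (hκle : κ₁ ≤ 𝔠.κ)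
    (hw1 : ∀ K k, k + 1 ≤ K → 𝔠.cB * (B10.rFun 𝔠.r₀ ((SK F 𝔠 γ hγ hγ1 K).gk k) * (SK F 𝔠 γ hγ hγ1 K).gk k *
        B10.pFun 𝔠.b₀ 𝔠.p₀ ((SK F 𝔠 γ hγ hγ1 K).gk k)) ≤ 𝔠.ρ / 4)
    (hw2 : ∀ K k, k + 1 ≤ K → 8 * (F.L : ℝ) ^ 2 * 𝔠.B₃ * 𝔠.Zfull *
        ((SK F 𝔠 γ hγ hγ1 K).gk k * B10.pFun 𝔠.b₀ 𝔠.p₀ ((SK F 𝔠 γ hγ hγ1 K).gk k)) ≤ 1 / 2)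
    {p₁ : ℝ} (hp : 𝔠.p₀ ≤ p₁) :
    TermSizeTrivT (AlphaInputsT3AC.dataOfV3chi p (canonPolymerCore fun K => (p K).toCore)) (canonPTCore fun K => (p K).toCore) 𝔠.b₀ p₁
      (max (newConst 𝔠) (oldConst 𝔠 * (F.L : ℝ) ^ 4 * Real.exp (κ₁ * (F.L : ℝ) ^ 3))) κ₁ :=
  termSizeTrivT_canonCore_profile (fun K => (p K).toCore) hκ₁ hκle hw1 hw2 hp

end Summit.QuantumFields.YangMills.Theorems.GlobalSlackCanonicalPolymers

end
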